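import Literature.NumberTheory.Sieve.SmoothTwistedSaddleWindow
import HarnessLib

/-!
# The twisted saddle point at the scales `x/e ≤ x`, `e ≤ (log x)^B`, to arbitrary relative precision

Topic `Literature/NumberTheory/Sieve`; a PROVED file sharpening `SmoothTwistedSaddleRange`
([HildebrandTenenbaum1986, §4], [Harper2016, §5]). There, `TwistedWeight.scaledSum_main_term` evaluates
`S_w(λ; x/e) = ∑_{n ∈ S(x/e, y)} W_λ(n/(x/e))` (`W_λ(v) = v²(1−v)²e(λv)`) in the range
`(log x)^4 ≤ y ≤ exp((log x)^{1/5})`, `1 ≤ e ≤ (log x)^{100}`, `|λ| ≤ Λ`, `Λ⁸ ≤ y`, as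
`e^{−α} 𝓜 Ŵ_λ(α)` up to `e^{−α}(ε + e^{−66}) 𝓜/(1+|λ|)`; the FIXED floor `e^{−66}` is the trace of the
hard-wired saddle window `100/√φ₂`. Here the window is `W/√φ₂` with `W = W(ε) = max(100, 160/ε)`
(`SaddleKernel.norm_kernelIntegral_sub_main_le_window`, `TwistedWeight.norm_scaledSum_sub_main_le_window`),
and the floor disappears:

`scaledSum_main_term_window`: for every `B : ℕ` and `ε > 0`, all large `x`,
`(log x)^4 ≤ y ≤ exp((log x)^{1/5})`, `1 ≤ Λ`, `Λ⁸ ≤ y`, `1 ≤ e ≤ (log x)^B`, `|λ| ≤ Λ`: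
`‖S_w(λ; x/e) − e^{−α} 𝓜 Ŵ_λ(α)‖ ≤ e^{−α} ε 𝓜/(1 + |λ|)`, `𝓜 = x^α ζ(α,y)/√(2π φ₂(α,y))`, `α = α(x,y)`.

This is the form needed when main terms at many scalings `e = 2^N q^v g d ≤ (log x)^B` have to be
matched to relative precision below any fixed constant. The proof is that of `scaledSum_main_term`:
the range facts are `TwistedWeight.twist_range`, the window hypotheses for `W/√φ₂` are
`SaddleKernel.window_range` (threshold `(169 W⁶/c)² ≤ log x`), the two Gaussian floors are
`SaddleKernel.window_floor_le`, and the remaining four error terms are the bookkeeping lemmas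
`err_window_le` (with `log e ≤ B log log x ≤ 5B (log x)^{1/5}`), `err_midrange_le`, `err_farrange_le`,
`err_decay_le` of `SmoothTwistedSaddleWindow`, each `≤ (5/8)(ε/2)`.

## References

* A. J. Harper, Compositio Math. 152 (2016), §5 [Harper2016].
* A. Hildebrand, G. Tenenbaum, Trans. AMS 296 (1986), §4 [HildebrandTenenbaum1986].
-/

noncomputable section

open Real Complex MeasureTheory Set Filter
open scoped FourierTransform Topology

namespace Literature.NumberTheory.Sieve

namespace TwistedWeight

set_option maxHeartbeats 1600000 in
/-- **The twisted smooth sums at the scales `x/e`, `1 ≤ e ≤ (log x)^B`, to relative precision `ε`.**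
For every `B : ℕ` and `ε > 0` there is `x₀` such that for `x ≥ x₀`, `(log x)^4 ≤ y ≤ exp((log x)^{1/5})`,
`1 ≤ Λ`, `Λ⁸ ≤ y`, `1 ≤ e ≤ (log x)^B` and `|λ| ≤ Λ`, with `α = α(x,y)`, `𝓜 = x^α ζ(α,y)/√(2π φ₂(α,y))`:
`‖∑_{n ∈ S(x/e, y)} (n e/x)²(1−ne/x)² e(λne/x) − e^{−α} 𝓜 Ŵ_λ(α)‖ ≤ e^{−α} ε 𝓜/(1+|λ|)`,
`Ŵ_λ(α) = ∫₀¹ v^{α+1}(1−v)² e(λv) dv` (no fixed floor: the saddle window is `max(100, 160/ε)/√φ₂`).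
The saddle-point evaluation of [HildebrandTenenbaum1986, §4] for the kernel `e^{−s} Ŵ_λ(s)` on the line
`Re s = α(x,y)`, as on the major arcs of [Harper2016, §5].
[cite: HildebrandTenenbaum1986, §4 (Lemmas 10–11)] [cite: Harper2016, §5] -/
theorem scaledSum_main_term_window (B : ℕ) (ε : ℝ) (hε : 0 < ε) :
    ∃ x₀ : ℝ, ∀ (x : ℝ) (y : ℕ), x₀ ≤ x → Real.log x ^ 4 ≤ (y : ℝ) →
      Real.log (y : ℝ) ≤ Real.log x ^ (1 / 5 : ℝ) →
      ∀ Λ : ℝ, 1 ≤ Λ → Λ ^ 8 ≤ (y : ℝ) → ∀ e : ℕ, 1 ≤ e → (e : ℝ) ≤ Real.log x ^ B → ∀ lam : ℝ, |lam| ≤ Λ →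
      ‖(∑ n ∈ Nat.smoothNumbersUpTo ⌊x / e⌋₊ (y + 1), twistWeight lam (n / (x / e))) -
          ((((e : ℝ) ^ (-saddlePoint x y) * (x ^ saddlePoint x y * smoothZeta (saddlePoint x y) y /
              Real.sqrt (2 * Real.pi * saddlePhi₂ (saddlePoint x y) y)) : ℝ)) : ℂ) *
            twistMellin lam (saddlePoint x y)‖ ≤
        (e : ℝ) ^ (-saddlePoint x y) * (ε * (x ^ saddlePoint x y * smoothZeta (saddlePoint x y) y /
          Real.sqrt (2 * Real.pi * saddlePhi₂ (saddlePoint x y) y)) / (1 + |lam|)) := by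
  obtain ⟨A₂, A₃, κ, c_φ, hA₂, hA₃, hκ, hc_φ, x₁, hR⟩ := twist_range
  -- the precision `δ = ε/2` of the five groups of error terms, and the window constant `W`
  obtain ⟨δ, hδ0, hδε⟩ : ∃ δ : ℝ, 0 < δ ∧ δ = ε / 2 := ⟨ε / 2, by positivity, rfl⟩
  obtain ⟨W, hW100, hWδ⟩ : ∃ W : ℝ, 100 ≤ W ∧ 80 ≤ W * δ := by
    refine ⟨max 100 (80 / δ), le_max_left _ _, ?_⟩
    have h := le_max_right 100 (80 / δ)
    rwa [div_le_iff₀ hδ0] at h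
  have hW0 : 0 < W := by linarith only [hW100]
  have hW1 : 1 ≤ W := by linarith only [hW100]
  -- thresholds on `L = log x`
  set Q : ℝ := 93 * 10 ^ 6 / (c_φ * δ ^ 2) with hQ
  set Q₃ : ℝ := 16400 * (B : ℝ) ^ 2 / (c_φ * δ ^ 2) with hQ₃
  set Qw : ℝ := 169 * W ^ 6 / c_φ with hQw
  set m : ℝ := max 1 (2 / A₃) with hm
  set L₁ : ℝ := max (max (max (max 16 (Q ^ 2)) (max (Q₃ ^ 2) (Qw ^ 2)))
    (max (122 * 10 ^ 7 / (A₂ ^ 10 * δ)) (147 * 10 ^ 6 * κ / δ))) (max (31000 / (κ ^ 2 * δ)) (m ^ 5)) with hL₁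
  refine ⟨max x₁ (Real.exp L₁), fun x y hx hy4 hylog Λ hΛ1 hΛy e he1 heL lam hlam => ?_⟩
  have hx₁ : x₁ ≤ x := le_trans (le_max_left _ _) hx
  obtain ⟨hx1, hy2, hα35, hα1, hφ0, hφlo, hφhi, hL16, hℓ11, -, hπℓ, -, hdec1, hT3, hdec2⟩ :=
    hR x y hx₁ hy4 hylog
  set α : ℝ := saddlePoint x y with hαdef
  have hα0 : 0 < α := by linarith only [hα35]
  set φ : ℝ := saddlePhi₂ α y with hφdef
  set Φ : ℝ := Real.sqrt φ with hΦ
  have hΦ0 : 0 < Φ := Real.sqrt_pos.2 hφ0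
  have hΦsq : Φ ^ 2 = φ := Real.sq_sqrt hφ0.le
  set L : ℝ := Real.log x with hL
  set ℓ : ℝ := Real.log y with hℓ
  set r : ℝ := L ^ (1 / 5 : ℝ) with hr
  have hL0 : 0 < L := by linarith only [hL16]
  have hℓ0 : 0 < ℓ := by linarith only [hℓ11]
  have hxexp : Real.exp L₁ ≤ x := le_trans (le_max_right _ _) hx
  have hLL₁ : L₁ ≤ L := by
    have := Real.log_le_log (Real.exp_pos _) hxexp; rwa [Real.log_exp] at this
  have hLQ : Q ^ 2 ≤ L :=
    le_trans (le_trans (le_trans (le_trans (le_max_right _ _) (le_max_left _ _)) (le_max_left _ _))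
      (le_max_left _ _)) hLL₁
  have hLQ₃ : Q₃ ^ 2 ≤ L :=
    le_trans (le_trans (le_trans (le_trans (le_max_left _ _) (le_max_right _ _)) (le_max_left _ _))
      (le_max_left _ _)) hLL₁
  have hLQw : Qw ^ 2 ≤ L :=
    le_trans (le_trans (le_trans (le_trans (le_max_right _ _) (le_max_right _ _)) (le_max_left _ _))
      (le_max_left _ _)) hLL₁
  have hLA₂ : 122 * 10 ^ 7 / (A₂ ^ 10 * δ) ≤ L :=
    le_trans (le_trans (le_trans (le_max_left _ _) (le_max_right _ _)) (le_max_left _ _)) hLL₁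
  have hLκ : 147 * 10 ^ 6 * κ / δ ≤ L :=
    le_trans (le_trans (le_trans (le_max_right _ _) (le_max_right _ _)) (le_max_left _ _)) hLL₁
  have hLκ2 : 31000 / (κ ^ 2 * δ) ≤ L := le_trans (le_trans (le_max_left _ _) (le_max_right _ _)) hLL₁
  have hLm : m ^ 5 ≤ L := le_trans (le_trans (le_max_right _ _) (le_max_right _ _)) hLL₁
  -- `r`
  have hr0 : 0 < r := Real.rpow_pos_of_pos hL0 _
  have hr5 : r ^ 5 = L := by
    rw [hr, ← Real.rpow_natCast, ← Real.rpow_mul hL0.le]; norm_num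
  have hr1 : 1 ≤ r := by
    by_contra h; push Not at h
    have : r ^ 5 < 1 := pow_lt_one₀ hr0.le h (by norm_num)
    linarith only [this, hr5, hL16]
  have hrm : m ≤ r := by
    by_contra h; push Not at h
    have hm0 : 0 ≤ m := le_trans zero_le_one (le_max_left _ _)
    have : r ^ 5 < m ^ 5 := pow_lt_pow_left₀ h hr0.le (by norm_num)
    linarith only [this, hr5, hLm]
  have hℓr : ℓ ≤ r := hylog
  have hℓL : ℓ ≤ L := by
    calc ℓ ≤ r := hℓr
      _ = r * 1 := (mul_one r).symm
      _ ≤ r * r ^ 4 := mul_le_mul_of_nonneg_left (one_le_pow₀ hr1) hr0.le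
      _ = L := by rw [← hr5]; ring
  -- `r⁴ ≥ Q`, `r⁴ ≥ Qw`, `r³ ≥ Q₃`
  have hsq_le : ∀ {q : ℝ} {k : ℕ}, 0 ≤ q → q ^ 2 ≤ L → 5 ≤ k * 2 → q ≤ r ^ k := by
    intro q k hq hqL hk
    have h1 : q ^ 2 ≤ (r ^ k) ^ 2 := by
      calc q ^ 2 ≤ L := hqL
        _ = r ^ 5 := hr5.symm
        _ ≤ r ^ (k * 2) := pow_le_pow_right₀ hr1 hk
        _ = (r ^ k) ^ 2 := pow_mul r k 2
    exact le_of_pow_le_pow_left₀ two_ne_zero (by positivity) h1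
  have hr4Q : Q ≤ r ^ 4 := hsq_le (by positivity) hLQ (by norm_num)
  have hr4Qw : Qw ≤ r ^ 4 := hsq_le (by positivity) hLQw (by norm_num)
  have hr3Q : Q₃ ≤ r ^ 3 := hsq_le (by positivity) hLQ₃ (by norm_num)
  -- `log e ≤ B log L ≤ 5 B r`
  have he0 : (0 : ℝ) < e := by exact_mod_cast he1
  have hloge : Real.log e ≤ 5 * B * r := by
    have h1 : Real.log e ≤ B * Real.log L := by
      calc Real.log e ≤ Real.log (L ^ B) := Real.log_le_log he0 heL
        _ = B * Real.log L := by rw [Real.log_pow]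
    have h2 : Real.log L ≤ 5 * r := by
      have := Real.log_le_rpow_div hL0.le (by norm_num : (0:ℝ) < 1 / 5)
      rw [← hr] at this; linarith only [this]
    have h3 : (B : ℝ) * Real.log L ≤ B * (5 * r) := mul_le_mul_of_nonneg_left h2 (Nat.cast_nonneg B)
    linarith only [h1, h3]
  -- `Φ ≤ 2L`, `y > 0`
  have hΦle : Φ ≤ 2 * L := by
    rw [hΦ, Real.sqrt_le_left (by positivity)]
    have h1 : L * ℓ ≤ L * L := mul_le_mul_of_nonneg_left hℓL hL0.le
    nlinarith only [hφhi, h1]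
  have hy0 : (0 : ℝ) < y := by exact_mod_cast lt_of_lt_of_le two_pos hy2
  -- ### the window `W/Φ` is admissible, apply the parametric theorem
  obtain ⟨-, hτ, hη⟩ := SaddleKernel.window_range hc_φ hW1 hℓ0 hr0 hr5 hℓr hφlo hr4Qw
  have hmain := norm_scaledSum_sub_main_le_window hx1 hy2 hα35 hα1 hφ0 hW0 hτ hπℓ hη hT3
    (Real.exp_pos _).le (Real.exp_pos _).le hdec1 hdec2 he1 lam
  rw [← hφdef] at hmain
  rw [← hℓ] at hmain
  rw [← hαdef] at hmain
  refine hmain.trans ?_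
  -- ### the main constant: `c = 𝓜 Φ/√(2π)`
  set M : ℝ := x ^ α * smoothZeta α y / Real.sqrt (2 * Real.pi * φ) with hM
  set ρ : ℝ := (e : ℝ) ^ (-α) with hρ
  have hρ0 : 0 < ρ := Real.rpow_pos_of_pos he0 _
  have hζ0 : 0 < smoothZeta α y := smoothZeta_pos hα0
  have hx0 : 0 < x := by linarith only [hx1]
  have hM0 : 0 < M := by rw [hM]; have := Real.pi_pos; positivity
  have hs2π : (5 / 2 : ℝ) ≤ Real.sqrt (2 * Real.pi) := by
    rw [Real.le_sqrt (by norm_num) (by positivity)]; have := Real.pi_gt_d2; nlinarith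
  have hs2π0 : 0 < Real.sqrt (2 * Real.pi) := by linarith only [hs2π]
  have hc : x ^ α * smoothZeta α y / (2 * Real.pi) = M * Φ / Real.sqrt (2 * Real.pi) := by
    have e' := SaddleKernel.main_const_identity hφ0 (x ^ α * smoothZeta α y)
    rw [← hM, Real.sqrt_div' _ hφ0.le, ← hΦ] at e'
    rw [← e']
    field_simp
  rw [hc]
  -- ### it suffices to bound `bracket · Φ · (1+|λ|) ≤ (5/2) ε`
  set Br : ℝ := (2950 * ℓ + 8 + 8 * Real.log e) / (φ * (1 + |lam|)) +
      2 / (1 + |lam|) * (Real.exp (-(W ^ 2 / 4)) * Real.sqrt (4 * Real.pi / φ)) +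
      ((2 / (1 + |lam|)) * Real.exp (-(W ^ 2 / 140)) * Real.sqrt (125 * Real.pi ^ 3 / φ) +
        20 * Real.pi * Real.exp (-(A₂ * r)) / (α * (1 + |lam|)) +
        2 * Real.pi * Real.exp (-(A₃ * r ^ 3)) * (κ * (y : ℝ) ^ (1 / 2 : ℝ)) +
        2 * Real.pi * (2 + 6 * (2 * π * |lam|) + 6 * (2 * π * |lam|) ^ 2 + (2 * π * |lam|) ^ 3) /
          (κ * (y : ℝ) ^ (1 / 2 : ℝ)) ^ 2) with hBr
  have hlam0 : 0 < 1 + |lam| := by positivity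
  suffices hkey : Br * Φ * (1 + |lam|) ≤ 5 / 2 * ε by
    have h1 : M * Φ / Real.sqrt (2 * Real.pi) * ρ * Br =
        ρ * ((Br * Φ * (1 + |lam|)) * (M / (Real.sqrt (2 * Real.pi) * (1 + |lam|)))) := by
      field_simp
    rw [h1]
    apply mul_le_mul_of_nonneg_left _ hρ0.le
    calc Br * Φ * (1 + |lam|) * (M / (Real.sqrt (2 * Real.pi) * (1 + |lam|)))
        ≤ 5 / 2 * ε * (M / (Real.sqrt (2 * Real.pi) * (1 + |lam|))) :=
          mul_le_mul_of_nonneg_right hkey (by positivity)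
      _ = ε * M / (1 + |lam|) * ((5 / 2) / Real.sqrt (2 * Real.pi)) := by
          field_simp
      _ ≤ ε * M / (1 + |lam|) * 1 := by
          apply mul_le_mul_of_nonneg_left _ (by positivity)
          rw [div_le_one hs2π0]; exact hs2π
      _ = ε * M / (1 + |lam|) := mul_one _
  -- ### expand `Br Φ (1+|λ|)` into six terms
  have hexpand : Br * Φ * (1 + |lam|) =
      (2950 * ℓ + 8 + 8 * Real.log e) / Φ +
      2 * Real.exp (-(W ^ 2 / 4)) * (Real.sqrt (4 * Real.pi / φ) * Φ) +
      2 * Real.exp (-(W ^ 2 / 140)) * (Real.sqrt (125 * Real.pi ^ 3 / φ) * Φ) +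
      20 * Real.pi * Real.exp (-(A₂ * r)) * Φ / α +
      2 * Real.pi * Real.exp (-(A₃ * r ^ 3)) * (κ * (y : ℝ) ^ (1 / 2 : ℝ)) * Φ * (1 + |lam|) +
      2 * Real.pi * (2 + 6 * (2 * π * |lam|) + 6 * (2 * π * |lam|) ^ 2 + (2 * π * |lam|) ^ 3) /
          (κ * (y : ℝ) ^ (1 / 2 : ℝ)) ^ 2 * Φ * (1 + |lam|) := by
    rw [hBr, ← hΦsq]
    field_simp
    ring
  rw [hexpand]
  -- `√(4π/φ) Φ = √(4π)`, `√(125π³/φ) Φ = √(125 π³)`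
  have hsq1 : Real.sqrt (4 * Real.pi / φ) * Φ = Real.sqrt (4 * Real.pi) := by
    rw [Real.sqrt_div' _ hφ0.le, hΦ]; field_simp
  have hsq2 : Real.sqrt (125 * Real.pi ^ 3 / φ) * Φ = Real.sqrt (125 * Real.pi ^ 3) := by
    rw [Real.sqrt_div' _ hφ0.le, hΦ]; field_simp
  rw [hsq1, hsq2]
  -- ### the six terms: `4 · (5/8)δ + (5/2)δ = 5δ = (5/2)ε`
  have hT1 : (2950 * ℓ + 8 + 8 * Real.log e) / Φ ≤ 5 / 8 * δ :=
    err_window_le hc_φ hδ0 hℓ11 hr1 hr5 hℓr hφlo hφ0 hloge hr4Q hr3Q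
  have hT23 : 2 * Real.exp (-(W ^ 2 / 4)) * Real.sqrt (4 * Real.pi) +
      2 * Real.exp (-(W ^ 2 / 140)) * Real.sqrt (125 * Real.pi ^ 3) ≤ 5 / 2 * δ :=
    SaddleKernel.window_floor_le hδ0 hW100 hWδ
  have hT4 : 20 * Real.pi * Real.exp (-(A₂ * r)) * Φ / α ≤ 5 / 8 * δ :=
    err_midrange_le hA₂ hδ0 hr0 hr5 hΦ0.le hΦle hα35 hLA₂
  have hT5 : 2 * Real.pi * Real.exp (-(A₃ * r ^ 3)) * (κ * (y : ℝ) ^ (1 / 2 : ℝ)) * Φ * (1 + |lam|) ≤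
      5 / 8 * δ :=
    err_farrange_le hA₃ hκ hδ0 hr1 hr5 (le_trans (le_max_right _ _) hrm) hΦ0.le hΦle hy0 hℓr hΛy hΛ1 hlam hLκ
  have hT6 : 2 * Real.pi * (2 + 6 * (2 * π * |lam|) + 6 * (2 * π * |lam|) ^ 2 + (2 * π * |lam|) ^ 3) /
      (κ * (y : ℝ) ^ (1 / 2 : ℝ)) ^ 2 * Φ * (1 + |lam|) ≤ 5 / 8 * δ :=
    err_decay_le hκ hδ0 hL0 hΦ0.le hΦle hy0 hy4 hΛy hΛ1 hlam hLκ2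
  have hsum := add_le_add (add_le_add (add_le_add hT1 hT23) hT4) (add_le_add hT5 hT6)
  linarith only [hsum, hδε]

end TwistedWeight

end Literature.NumberTheory.Sieve

end
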